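import Literature.MathematicalPhysics.QuantumFieldTheory.Balaban1983to89.B4Ineq53RegularRegion
import Literature.MathematicalPhysics.QuantumFieldTheory.Balaban1983to89.B4TorusRegionOp

/-!
# `Balaban1983to89.B4Ineq115TorusRegular` — [Balaban1983RegularityDecay] «Proposition 2.3 of [1]» (1.15) p. 574,
# `γ₀I ≤ Δ^{(k)}(Ω,A) + aL^{−2}P(A) ≤ γ₁I`, ON A REGION OF THE DISCRETE TORUS AT A (1.7)-REGULAR TORUS FIELD `A ≠ 0`
# — transferred from the lattice region of representatives (p17's (5.1)–(5.3)) by operator monotonicity of the inverse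

statement-level skeleton of published theorems with citation tags; proofs where landed; nothing here is a claim about the Yang–Mills mass gap

CITATION HEADER.  T. Bałaban, *Regularity and decay of lattice Green's functions*, Commun. Math. Phys. **89** (1983)
571–597, doi:10.1007/bf01214744 [Balaban1983RegularityDecay] (cell paper B4; held text
`paper:balaban1983-cmp89-regularity-decay`, journal page = PDF page + 570; p. 572 (1.3)–(1.7) and «operators on subsets
of a torus T_η», p. 573 (1.13)–(1.14), p. 574 (1.15), p. 593 (5.1)–(5.3)).  Cell `pub-ymgap`, Track-A seat
`pub-ymgap-dag-p3` gen 2 (node N01 of YM-PLAN §2; located flag F-torusU of row N01: «Prop. 2.3 is typed on regions of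
`ηℤ^{d+1}`, not torus regions — print's primary setting p. 572; ADMIT, R325 D2»; this module supplies the (1.15) third of
the torus version at a regular `A ≠ 0` on r01's torus carrier).  THEOREMS ONLY: no `def`, no `Prop`-valued fact, no
`sorry`; axioms standard.  USED BY NAME, never restated: r01's §5-route dictionary `B4GaussRep36.{kForm, gk, deltaK, pOp}`
and `B4Ineq115Sect3Route.form115_upper`, p17's `B4Cor23Rep36Bridge.{hamR, QkR, QkR_eq, kForm_eq_regionOp, gk_eq_green}`,
`B4Ineq53RegularRegion.{form115_lower_regular, gamLow, gam0}`, `B4NextAvg52.{nextAvg, rowOrtho_nextAvg}`,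
`B4Sect3BlockAveraging.dotProduct_pOp_mulVec_le`, b04's region calculus (`B4Lemma21Region.regionOp`,
`B4Lower18RegularRegion.{regWt, rBlkWt, rbaseEmb, rstairContour, compField}`, `B4GaugeCovariance.{b4Op, covOp, covLap,
projOp, avgOp, fieldLink}`), p35's `B4Eq16GreenExists.b4Op_region_posDef`, r01 g9's torus objects
`B4TorusRegionOp.{per, twrap, torWt, torBond, torusOp, perField, regionOp_form_le_torusOp_form, contourTrans_tor_eq,
torusOp_posDef, val_mem_perBox, twrap_eq_self}`.

WHAT IS PRINTED (verbatim).  p. 574: «Proposition 2.3 of [1]. There exist positive constants δ₀, c₀, γ₀, γ₁ dependent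
on d and M only and such that for arbitrary Λ ⊂ Ω^{(k)} = Ω∩Z^d, Λ being a sum of big blocks and for e sufficiently
small, we have γ₀I ≤ Δ^{(k)}(Ω, A) + aL^{−2}P(A) ≤ γ₁I, (1.15)»; p. 573: «Δ^{(k)}(Ω, A) = a_kI − a_k²Q_k(A)G_k(Ω, A)Q_k^*(A),
(1.14)»; p. 572: «Another common case is to consider operators on subsets of a torus T_η which we identify with a
rectangular parallelepiped in ηZ^d with periodic conditions.»; p. 593: «The upper bound is quite elementary because
Δ^{(k)}(Ω,A) + aL^{−2}P(A) = a_kI − a_k²Q_k(A)G_k(Ω,A)Q_k^*(A) + aL^{−2}P(A) ≦ a_kI + aL^{−2}Q^*(A)Q(A) ≦ (a_k + aL^{−2})I.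
(5.1) … ⟨φ, (Δ^{(k)}(Ω,A) + aL^{−2}P(A))φ⟩ ≧ γ₀′⟨φ,φ⟩ − O(e^{2−δ})⟨φ,φ⟩ ≧ γ₀″⟨φ,φ⟩. (5.3)».

DICTIONARY (lattice units, `d+1` dimensions; as p17's files with the torus objects of r01 g9).  Fine mesh `n = L^k`
points per unit; the unit torus `T^{(k)} = Π_ν ℤ/(L·P′_ν)` has `P′_ν` blocks of the NEXT scale (`L`-blocks) per
direction, `P = per L P′` unit blocks, fine period `per n P`; the torus region `Ω^{(k)} = fineDom L Z_T`, `Z_T ⊆ Π_ν[0,P′_ν)`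
the `L`-block labels (so the `L`-blocks of `P(A)` and the unit blocks of `Q_k(A)` do not wrap); fine region
`Ω = fineDom n Ω^{(k)}` read on representatives; torus field `A_ν(x)` on the fine period box, its periodic extension
`perField n P A`.  `G_k(Ω,A)` on the torus = `(torusOp …)⁻¹` (1.6) with the TORUS Neumann Laplacian (`torWt`: the
wrap-around bonds of `Ω` included); `Q_k(A)` = `QkR … (perField n P A)` (block averages with the staircase transporters —
inside unit blocks the torus field IS the periodic lattice field, `contourTrans_tor_eq`); `aL^{−2}P(A)` =
`(a′L^{−2})•pOp L^{d+1} (nextAvg … (perField n P A))`; the torus form matrix of `−Δ^{η,N}_{A,Ω} + m²` is written out as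
`covLap (torWt …) (fieldLink … torBond …) + m²•1` (no new name is introduced); (1.7) on the torus region = the torus
forward differences `A_ν(x + ηe_μ mod T) − A_ν(x)` (as r01's `torusPairFam.regular`).

WHAT THIS MODULE PROVES (all in full).
* §1 `inv_form_antitone` — OPERATOR MONOTONICITY OF THE INVERSE: `0 < P ≤ R` as forms ⇒ `R⁻¹ ≤ P⁻¹` as forms
  (variational inequality `2⟨x,y⟩ − ⟨y,Py⟩ ≤ ⟨x,P⁻¹x⟩`); `conj_form_mono` — congruence `M ≤ N ⇒ BMBᵀ ≤ BNBᵀ`.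
* §2 `kForm_torus_eq` — r01's `kForm H a_k Q_k` at the torus form matrix and `Q_k(A^per)` IS r01 g9's `torusOp`
  (`G_k(Ω,A)` on the torus = `gk …`, `gk_torus_eq`); `torus_green_form_le` — **`G_k^{T}(Ω,A) ≤ G_k^{ℤ}(Ω,A^per)` as
  forms** (the torus form dominates the Neumann form of the fundamental domain, both positive definite for every `A`);
  hence `deltaK_torus_form_ge` — **`Δ^{(k)}_T(Ω,A) ≥ Δ^{(k)}_ℤ(Ω,A^per)` as forms** ((1.14): the `Q_k` agree, `−a_k²Q_kGQ_k^*`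
  is antitone in `G`).
* §3 **`form115_lower_torus`** — (1.15) LOWER BOUND ON THE TORUS at a (1.7)-regular torus field: `γ₀″|φ|² ≤
  ⟨φ, (Δ^{(k)}_T(Ω,A) + a′L^{−2}P(A))φ⟩` with p17's explicit `γ₀″ = gamLow d L a a′ m²₊`, for every mesh `n ≥ 1`,
  `L ≥ 1`, every torus (`P′_ν ≥ 1` `L`-blocks per direction, fine period `≥ 3`), every union `Ω^{(k)}` of `L`-blocks of
  the unit torus, every `m² ∈ [0, m²₊]`, under p17's smallness binders («e sufficiently small») — from p17's
  `form115_lower_regular` at the periodic field on the region of representatives and §2;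
  **`form115_upper_torus`** — (5.1) = (1.15) UPPER BOUND ON THE TORUS, `γ₁ = a_k + a′L^{−2}`, for EVERY field
  (r01's `form115_upper`: `G_k^T(Ω,A) > 0` for every `A` by `torusOp_posDef`, `P(A) ≤ I` by `rowOrtho_nextAvg`);
  `form115_torus` — both bounds packaged in the shape of the `form115 γ₀ γ₁` field of b04's `B4.UnitSetting`.
HONEST SCOPE.  (1.15) only — the kernel bounds (1.16)–(1.20) on the torus at `A ≠ 0` (§5 route: Sect. 5 Theorem with
(5.4)–(5.5) from `B4Cor23TorusPairFam`) are NOT in this file; no torus `UnitSetting` family is defined here (a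
definitions module, review lane, is the next step).  The route (Löwner transfer from the fundamental domain) is OUR
device: the print proves (5.3) directly; the constant is p17's lattice `γ₀″` (the wrap-around bonds only help).  (1.7)
is taken on the fine region `Ω` with torus differences; `L`-blocks and unit blocks do not wrap by construction
(`P = per L P′`).  Count-neutral for YM-PLAN (typed 28∕28 · discharged 0∕28 unmoved); nothing here concerns the
continuum, ℝ⁴, OS axioms, a mass gap or the Clay problem.
-/

namespace Literature.MathematicalPhysics.QuantumFieldTheory.Balaban1983to89.B4Ineq115TorusRegular

open Finset Matrix
open Literature.MathematicalPhysics.QuantumFieldTheory.Balaban1983to89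
open Literature.MathematicalPhysics.QuantumFieldTheory.Balaban1983to89.B4GaugeCovariance
open Literature.MathematicalPhysics.QuantumFieldTheory.Balaban1983to89.B4GaussRep36 (kForm gk pOp)
open Literature.MathematicalPhysics.QuantumFieldTheory.Balaban1983to89.B4Lower18 (fineDom mem_fineDom)
open Literature.MathematicalPhysics.QuantumFieldTheory.Balaban1983to89.B4Lower18Regular (e1)
open Literature.MathematicalPhysics.QuantumFieldTheory.Balaban1983to89.B4Lower18RegularRegion (regWt rBlkWt rbaseEmb
  rstairContour compField)
open Literature.MathematicalPhysics.QuantumFieldTheory.Balaban1983to89.B4Reflection242 (boxDom)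
open Literature.MathematicalPhysics.QuantumFieldTheory.Balaban1983to89.B4Lemma21Region (regionOp)
open Literature.MathematicalPhysics.QuantumFieldTheory.Balaban1983to89.B4Eq16GreenExists (b4Op_region_posDef)
open Literature.MathematicalPhysics.QuantumFieldTheory.Balaban1983to89.B4Cor23RegionDeltaAlg (lnk trn)
open Literature.MathematicalPhysics.QuantumFieldTheory.Balaban1983to89.B1Prop22RegularFieldAlg (avgR)
open Literature.MathematicalPhysics.QuantumFieldTheory.Balaban1983to89.B4Cor23Rep36Bridge (hamR QkR QkR_eq
  kForm_eq_regionOp gk_eq_green hamR_isSymm)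
open Literature.MathematicalPhysics.QuantumFieldTheory.Balaban1983to89.B4NextAvg52 (nextAvg rowOrtho_nextAvg)
open Literature.MathematicalPhysics.QuantumFieldTheory.Balaban1983to89.B4Sect3BlockAveraging (dotProduct_pOp_mulVec_le)
open Literature.MathematicalPhysics.QuantumFieldTheory.Balaban1983to89.B4Ineq53RegularRegion (gam0 gamLow gamLow_pos
  form115_lower_regular)
open Literature.MathematicalPhysics.QuantumFieldTheory.Balaban1983to89.B4TorusRegionOp

noncomputable section

variable {d : ℕ} {ι : Type} [Fintype ι] [DecidableEq ι]

/-! ## §1. Operator monotonicity of the inverse; congruence -/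

/-- the variational inequality `2⟨x,y⟩ − ⟨y,Py⟩ ≤ ⟨x,P⁻¹x⟩` of a positive definite real symmetric `P`
(complete the square `⟨(y − P⁻¹x), P(y − P⁻¹x)⟩ ≥ 0`). [folklore] -/
private theorem two_dotProduct_sub_form_le {Λ : Type} [Fintype Λ] [DecidableEq Λ] {P : Matrix Λ Λ ℝ} (hP : P.PosDef)
    (x y : Λ → ℝ) : 2 * (x ⬝ᵥ y) - y ⬝ᵥ (P *ᵥ y) ≤ x ⬝ᵥ (P⁻¹ *ᵥ x) := by
  have hPs : Pᵀ = P := by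
    have h := hP.isHermitian.eq
    rwa [conjTranspose_eq_transpose_of_trivial] at h
  have hdet : IsUnit P.det := isUnit_iff_ne_zero.2 hP.det_pos.ne'
  set z : Λ → ℝ := P⁻¹ *ᵥ x with hz
  have hPz : P *ᵥ z = x := by rw [hz, Matrix.mulVec_mulVec, Matrix.mul_nonsing_inv _ hdet, Matrix.one_mulVec]
  have h0 := hP.posSemidef.dotProduct_mulVec_nonneg (y - z)
  rw [star_trivial, Matrix.mulVec_sub, hPz, sub_dotProduct, dotProduct_sub, dotProduct_sub] at h0
  have h1 : z ⬝ᵥ (P *ᵥ y) = y ⬝ᵥ x := by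
    rw [Matrix.dotProduct_mulVec, ← Matrix.mulVec_transpose, hPs, hPz, dotProduct_comm]
  have h2 : z ⬝ᵥ x = x ⬝ᵥ z := dotProduct_comm _ _
  have h3 : y ⬝ᵥ x = x ⬝ᵥ y := dotProduct_comm _ _
  linarith

/-- **OPERATOR MONOTONICITY OF THE INVERSE (Löwner)**: for positive definite real symmetric `P`, `R` with `P ≤ R` as
forms, `R⁻¹ ≤ P⁻¹` as forms. [folklore] -/
private theorem inv_form_antitone {Λ : Type} [Fintype Λ] [DecidableEq Λ] {P R : Matrix Λ Λ ℝ} (hP : P.PosDef)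
    (hR : R.PosDef) (hPR : ∀ y : Λ → ℝ, y ⬝ᵥ (P *ᵥ y) ≤ y ⬝ᵥ (R *ᵥ y)) (x : Λ → ℝ) :
    x ⬝ᵥ (R⁻¹ *ᵥ x) ≤ x ⬝ᵥ (P⁻¹ *ᵥ x) := by
  have hdet : IsUnit R.det := isUnit_iff_ne_zero.2 hR.det_pos.ne'
  set y : Λ → ℝ := R⁻¹ *ᵥ x with hy
  have hRy : R *ᵥ y = x := by rw [hy, Matrix.mulVec_mulVec, Matrix.mul_nonsing_inv _ hdet, Matrix.one_mulVec]
  have h1 : x ⬝ᵥ y = y ⬝ᵥ (R *ᵥ y) := by rw [hRy, dotProduct_comm]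
  have h2 := two_dotProduct_sub_form_le hP x y
  have h3 := hPR y
  linarith

/-- congruence preserves the form order: `M ≤ N ⇒ BMBᵀ ≤ BNBᵀ`. [folklore] -/
private theorem conj_form_mono {X Y : Type} [Fintype X] [Fintype Y] {M N : Matrix X X ℝ} (B : Matrix Y X ℝ)
    (h : ∀ y : X → ℝ, y ⬝ᵥ (M *ᵥ y) ≤ y ⬝ᵥ (N *ᵥ y)) (u : Y → ℝ) :
    u ⬝ᵥ ((B * M * Bᵀ) *ᵥ u) ≤ u ⬝ᵥ ((B * N * Bᵀ) *ᵥ u) := by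
  have key : ∀ K : Matrix X X ℝ, u ⬝ᵥ ((B * K * Bᵀ) *ᵥ u) = (Bᵀ *ᵥ u) ⬝ᵥ (K *ᵥ (Bᵀ *ᵥ u)) := by
    intro K
    rw [← Matrix.mulVec_mulVec, ← Matrix.mulVec_mulVec, Matrix.dotProduct_mulVec u B, ← Matrix.mulVec_transpose]
  rw [key, key]
  exact h _

/-! ## §2. The torus dictionary: `kForm` at the torus form matrix IS `torusOp`; `G^T ≤ G^ℤ`; `Δ^{(k)}_T ≥ Δ^{(k)}_ℤ` -/

section Torus

variable (F : OrthFlow ι) (e : ℝ) {n : ℕ} (hn : 1 ≤ n) {P : Fin (d + 1) → ℕ}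
  (h3 : ∀ ν, 3 ≤ per n P ν) {ΩT : Finset (Fin (d + 1) → ℤ)} (hΩ : ΩT ⊆ boxDom P)
  (Ac : (Fin (d + 1) → ℤ) → Fin (d + 1) → ℝ)

/-- `torusOp` unfolded: `−Δ^{η,N}_{A,Ω}` (torus bonds) `+ m² + a_kη^{d+1}·Q^*Q` with the staircase transporters of the torus
field. [cite: Balaban1983RegularityDecay, (1.3)–(1.6) p.572 «operators on subsets of a torus T_η»] -/
theorem torusOp_eq (a m2 : ℝ) :
    torusOp F e hn a m2 P ΩT Ac
      = covLap (torWt n P (fineDom n ΩT)) (fieldLink F (e / n) fun u v : ↥(fineDom n ΩT) => torBond n P Ac u.1 v.1)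
        + m2 • (1 : Matrix _ _ ℝ)
        + (a * ((n : ℝ) ^ (d + 1))⁻¹) • projOp (rBlkWt n ΩT (fineDom n ΩT))
            (contourTrans (fieldLink F (e / n) fun u v : ↥(fineDom n ΩT) => torBond n P Ac u.1 v.1) (rbaseEmb hn ΩT)
              (rstairContour hn ΩT)) := rfl

include hn h3 hΩ in
/-- **r01's `kForm H a_k Q_k` AT THE TORUS FORM MATRIX `H = −Δ^{η,N}_{A,Ω} + m²` (torus bonds) AND `Q_k = Q_k(A^per)` IS
r01 g9's `torusOp`** — the block averages of the torus region are those of the fundamental domain at the periodic field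
(`contourTrans_tor_eq`: unit blocks do not wrap). [cite: Balaban1983RegularityDecay, (1.6) p.572, (1.4) p.572] -/
theorem kForm_torus_eq (a m2 : ℝ) :
    kForm (covLap (torWt n P (fineDom n ΩT)) (fieldLink F (e / n) fun u v : ↥(fineDom n ΩT) => torBond n P Ac u.1 v.1)
        + m2 • (1 : Matrix _ _ ℝ)) a (QkR F e hn ΩT (perField n P Ac))
      = torusOp F e hn a m2 P ΩT Ac := by
  have hs : (0 : ℝ) ≤ ((n : ℝ) ^ (d + 1))⁻¹ := by positivity
  rw [torusOp_eq, contourTrans_tor_eq F hn h3 hΩ, kForm, QkR_eq, Matrix.transpose_smul, Matrix.smul_mul,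
    Matrix.mul_smul, smul_smul, smul_smul, mul_assoc, Real.mul_self_sqrt hs]
  rfl

include hn h3 hΩ in
/-- **`G_k(Ω,A)` ON THE TORUS = r01's `gk` at the torus form matrix.** [cite: Balaban1983RegularityDecay, (1.6) p.572] -/
theorem gk_torus_eq (a m2 : ℝ) :
    gk (covLap (torWt n P (fineDom n ΩT)) (fieldLink F (e / n) fun u v : ↥(fineDom n ΩT) => torBond n P Ac u.1 v.1)
        + m2 • (1 : Matrix _ _ ℝ)) a (QkR F e hn ΩT (perField n P Ac))
      = (torusOp F e hn a m2 P ΩT Ac)⁻¹ := by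
  rw [gk, kForm_torus_eq F e hn h3 hΩ Ac a m2]

include h3 hΩ in
/-- **`G_k^{T}(Ω, A) ≤ G_k^{ℤ}(Ω, A^per)` AS FORMS** (`a > 0`, `m² ≥ 0`, every field): the torus operator (1.6) dominates
the Neumann operator of the fundamental domain at the periodic field (`regionOp_form_le_torusOp_form`), both are
positive definite for every `A` (`b4Op_region_posDef`, `torusOp_posDef`), and inversion reverses the form order (§1).
[cite: Balaban1983RegularityDecay, (1.6) p.572, (1.8) p.573 (bookkeeping: torus vs periodic fundamental domain)] -/
theorem torus_green_form_le {a : ℝ} (ha : 0 < a) {m2 : ℝ} (hm : 0 ≤ m2) (x : ↥(fineDom n ΩT) × ι → ℝ) :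
    x ⬝ᵥ ((torusOp F e hn a m2 P ΩT Ac)⁻¹ *ᵥ x)
      ≤ x ⬝ᵥ ((regionOp F e hn a m2 ΩT (perField n P Ac))⁻¹ *ᵥ x) :=
  inv_form_antitone
    (b4Op_region_posDef F (e / n) hn ha hm ΩT fun u v : ↥(fineDom n ΩT) => compField (perField n P Ac) u.1 v.1)
    (torusOp_posDef F hn hΩ e ha hm Ac) (regionOp_form_le_torusOp_form F hn h3 hΩ e a m2 Ac) x

include h3 hΩ in
/-- **`Δ^{(k)}_T(Ω,A) ≥ Δ^{(k)}_ℤ(Ω,A^per)` AS FORMS** ((1.14) `Δ^{(k)} = a_kI − a_k²Q_kG_kQ_k^*`: the block averages `Q_k`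
of the torus region and of the fundamental domain coincide, and `−a_k²Q_kGQ_k^*` is antitone in `G`).
[cite: Balaban1983RegularityDecay, (1.14) p.573 (bookkeeping: torus vs periodic fundamental domain)] -/
theorem deltaK_torus_form_ge {a : ℝ} (ha : 0 < a) {m2 : ℝ} (hm : 0 ≤ m2) (ψ : ↥ΩT × ι → ℝ) :
    ψ ⬝ᵥ (B4GaussRep36.deltaK (hamR F e m2 ΩT (perField n P Ac) n) a (QkR F e hn ΩT (perField n P Ac)) *ᵥ ψ)
      ≤ ψ ⬝ᵥ (B4GaussRep36.deltaK (covLap (torWt n P (fineDom n ΩT))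
            (fieldLink F (e / n) fun u v : ↥(fineDom n ΩT) => torBond n P Ac u.1 v.1) + m2 • (1 : Matrix _ _ ℝ)) a
          (QkR F e hn ΩT (perField n P Ac)) *ᵥ ψ) := by
  have hT := gk_torus_eq F e hn h3 hΩ Ac a m2
  have hZ := gk_eq_green F e hn a m2 ΩT (perField n P Ac)
  simp only [B4GaussRep36.deltaK, Matrix.sub_mulVec, Matrix.one_mulVec, dotProduct_sub, Matrix.smul_mulVec, dotProduct_smul, smul_eq_mul, hT, hZ]
  have hc := conj_form_mono (QkR F e hn ΩT (perField n P Ac)) (torus_green_form_le F e hn h3 hΩ Ac ha hm) ψ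
  nlinarith [mul_le_mul_of_nonneg_left hc (sq_nonneg a)]

end Torus

/-! ## §3. (1.15) on the torus at a (1.7)-regular torus field -/

section Form115

variable (F : OrthFlow ι) {e : ℝ} {n L : ℕ} (hn : 1 ≤ n) (hL : 1 ≤ L)
  {P' : Fin (d + 1) → ℕ} (ZcT : Finset (Fin (d + 1) → ℤ)) (hZ : ZcT ⊆ boxDom P')
  (h3 : ∀ ν, 3 ≤ per n (per L P') ν)

include hL hZ in
/-- the unit labels of a union of `L`-blocks of the unit torus lie in the period box `Π_ν[0, L·P′_ν)`.
[cite: Balaban1983RegularityDecay, p.572 «a torus T_η … with periodic conditions», dictionary] -/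
theorem fineDom_subset_perBox : fineDom L ZcT ⊆ boxDom (per L P') :=
  fun x hx => val_mem_perBox hL hZ ⟨x, hx⟩

include hZ h3 in
/-- **(5.1) = (1.15), UPPER BOUND, ON THE TORUS, FOR EVERY FIELD**: `⟨φ, (Δ^{(k)}_T(Ω,A) + a′L^{−2}P(A))φ⟩ ≤
(a_k + a′L^{−2})|φ|²` — r01's `form115_upper` with `G_k^T(Ω,A) > 0` for every `A` (`torusOp_posDef`) and `P(A) ≤ I`
(`rowOrtho_nextAvg`). [cite: Balaban1983RegularityDecay, (1.15) p.574, (5.1) p.593] -/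
theorem form115_upper_torus {a : ℝ} (ha : 0 < a) {a' : ℝ} (ha' : 0 ≤ a') {m2 : ℝ} (hm : 0 ≤ m2)
    (Ac : (Fin (d + 1) → ℤ) → Fin (d + 1) → ℝ) (ψ : ↥(fineDom L ZcT) × ι → ℝ) :
    ψ ⬝ᵥ ((B4GaussRep36.deltaK (covLap (torWt n (per L P') (fineDom n (fineDom L ZcT)))
            (fieldLink F (e / n) fun u v : ↥(fineDom n (fineDom L ZcT)) => torBond n (per L P') Ac u.1 v.1)
            + m2 • (1 : Matrix _ _ ℝ)) a (QkR F e hn (fineDom L ZcT) (perField n (per L P') Ac))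
          + (a' * ((L : ℝ) ^ 2)⁻¹) • pOp (((L ^ (d + 1) : ℕ) : ℝ))
              (nextAvg F (e / n) hL ZcT n (perField n (per L P') Ac))) *ᵥ ψ)
      ≤ (a + a' * ((L : ℝ) ^ 2)⁻¹) * (ψ ⬝ᵥ ψ) := by
  have hL0 : (((L ^ (d + 1) : ℕ) : ℝ)) ≠ 0 := by
    have : 0 < L ^ (d + 1) := pow_pos hL _
    exact_mod_cast this.ne'
  have hK : (kForm (covLap (torWt n (per L P') (fineDom n (fineDom L ZcT)))
      (fieldLink F (e / n) fun u v : ↥(fineDom n (fineDom L ZcT)) => torBond n (per L P') Ac u.1 v.1)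
      + m2 • (1 : Matrix _ _ ℝ)) a (QkR F e hn (fineDom L ZcT) (perField n (per L P') Ac))).PosDef := by
    rw [kForm_torus_eq F e hn h3 (fineDom_subset_perBox hL ZcT hZ) Ac a m2]
    exact torusOp_posDef F hn (fineDom_subset_perBox hL ZcT hZ) e ha hm Ac
  exact B4Ineq115Sect3Route.form115_upper _ _ _ hK (by positivity)
    (fun v => dotProduct_pOp_mulVec_le (rowOrtho_nextAvg F (e / n) hL ZcT n (perField n (per L P') Ac)) hL0 v) ψ

section Lower

variable {ℓ : ℝ} (hℓ : 0 ≤ ℓ)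
  (hLip : ∀ t (v : ι → ℝ), ((F.U t - 1) *ᵥ v) ⬝ᵥ ((F.U t - 1) *ᵥ v) ≤ (ℓ * t) ^ 2 * (v ⬝ᵥ v))
  (he : 0 < e) {a : ℝ} (ha : 0 < a) {a' : ℝ} (ha' : 0 < a')
  {m2 m2max : ℝ} (hm : 0 ≤ m2) (hmm : m2 ≤ m2max)
  {Ac : (Fin (d + 1) → ℤ) → Fin (d + 1) → ℝ} {c β : ℝ} (hc : 0 ≤ c)
  (h17T : ∀ x ∈ fineDom n (fineDom L ZcT), ∀ μ ν : Fin (d + 1),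
    |Ac (twrap n (per L P') (x + e1 μ)) ν - Ac x ν| ≤ c * e ^ (β - 1) / n)
  (hsmall : ℓ ^ 2 * ((d + 1) * c * e ^ β) ^ 2 * (d + 1) * (1 + a * (d + 1)) ≤ min 2 a / 4)
  (hsmallU : ℓ ^ 2 * ((d + 1) * ((L : ℝ) ^ 2 * c) * e ^ β) ^ 2 * (d + 1)
      * (1 + (a' / gam0 d a m2max) * (d + 1)) ≤ min 2 (a' / gam0 d a m2max) / 4)
  (hX : gam0 d a m2 * (6 * (d + 1) * (a / (min 2 a / 4 + m2)) ^ 2 * (ℓ * ((3 * d + 4) * c * e ^ β)) ^ 2)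
      ≤ gamLow d L a a' m2max)

include hn hL hZ h17T in
/-- **(1.7) TRANSFERS TO THE PERIODIC FIELD ON THE FUNDAMENTAL DOMAIN**: the torus forward differences of `A` on `Ω` are
the lattice forward differences of `A^per` there. [cite: Balaban1983RegularityDecay, (1.7) p.572] -/
theorem regular_perField : ∀ x ∈ fineDom n (fineDom L ZcT), ∀ μ ν : Fin (d + 1),
    |perField n (per L P') Ac (x + e1 μ) ν - perField n (per L P') Ac x ν| ≤ c * e ^ (β - 1) / n := by
  intro x hx μ ν
  have hxT : twrap n (per L P') x = x :=
    twrap_eq_self (val_mem_perBox hn (fineDom_subset_perBox hL ZcT hZ) ⟨x, hx⟩)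
  simp only [perField, hxT]
  exact h17T x hx μ ν

include hℓ hLip he ha ha' hm hmm hZ h3 hc h17T hsmall hsmallU hX in
/-- **(1.15), LOWER BOUND, ON THE TORUS AT A (1.7)-REGULAR TORUS FIELD, EXPLICIT CONSTANT**: for every mesh `n ≥ 1`,
`L ≥ 1`, every unit torus with `P′_ν` `L`-blocks per direction (fine period `≥ 3`), every union `Ω^{(k)} = fineDom L Z_T`
of its `L`-blocks, every `m² ∈ [0, m²₊]`, every torus field with (1.7) on `Ω` and `e` small (p17's three binders):
`γ₀″|φ|² ≤ ⟨φ, (Δ^{(k)}_T(Ω,A) + a′L^{−2}P(A))φ⟩`, `γ₀″ = gamLow d L a a′ m²₊` — p17's (5.2)–(5.3) on the region of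
representatives at `A^per`, then `Δ^{(k)}_T ≥ Δ^{(k)}_ℤ` (§2); `P(A)` is the same operator on both sides.
[cite: Balaban1983RegularityDecay, (1.15) p.574, (5.2)–(5.3) p.593; p.572 «operators on subsets of a torus T_η»] -/
theorem form115_lower_torus (ψ : ↥(fineDom L ZcT) × ι → ℝ) :
    gamLow d L a a' m2max * (ψ ⬝ᵥ ψ)
      ≤ ψ ⬝ᵥ ((B4GaussRep36.deltaK (covLap (torWt n (per L P') (fineDom n (fineDom L ZcT)))
            (fieldLink F (e / n) fun u v : ↥(fineDom n (fineDom L ZcT)) => torBond n (per L P') Ac u.1 v.1)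
            + m2 • (1 : Matrix _ _ ℝ)) a (QkR F e hn (fineDom L ZcT) (perField n (per L P') Ac))
          + (a' * ((L : ℝ) ^ 2)⁻¹) • pOp (((L ^ (d + 1) : ℕ) : ℝ))
              (nextAvg F (e / n) hL ZcT n (perField n (per L P') Ac))) *ᵥ ψ) := by
  have hreg := regular_perField hn hL ZcT hZ h17T
  have hlat := form115_lower_regular F hℓ hLip he hn hL ha ha' hm hmm ZcT hc hreg hsmall hsmallU hX ψ
  have hΔ := deltaK_torus_form_ge F e hn (P := per L P') h3 (fineDom_subset_perBox hL ZcT hZ) Ac ha hm ψ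
  rw [Matrix.add_mulVec, dotProduct_add] at hlat ⊢
  linarith

include hℓ hLip he ha ha' hm hmm hZ h3 hc h17T hsmall hsmallU hX in
/-- **(1.15) ON THE TORUS, BOTH BOUNDS, IN THE SHAPE OF THE FIELD `form115 γ₀ γ₁` OF b04's `B4.UnitSetting`**
(`γ₀ = gamLow d L a a′ m²₊`, `γ₁ = a_k + a′L^{−2}`): the (1.15) third of «Proposition 2.3 of [1]» for torus regions at a
(1.7)-regular `A ≠ 0` on r01's carrier. [cite: Balaban1983RegularityDecay, Prop. 2.3 of [1] (1.15) p.574; p.572 (torus)] -/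
theorem form115_torus : ∀ ψ : ↥(fineDom L ZcT) × ι → ℝ,
    gamLow d L a a' m2max * (ψ ⬝ᵥ ψ)
      ≤ ψ ⬝ᵥ ((B4GaussRep36.deltaK (covLap (torWt n (per L P') (fineDom n (fineDom L ZcT)))
            (fieldLink F (e / n) fun u v : ↥(fineDom n (fineDom L ZcT)) => torBond n (per L P') Ac u.1 v.1)
            + m2 • (1 : Matrix _ _ ℝ)) a (QkR F e hn (fineDom L ZcT) (perField n (per L P') Ac))
          + (a' * ((L : ℝ) ^ 2)⁻¹) • pOp (((L ^ (d + 1) : ℕ) : ℝ))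
              (nextAvg F (e / n) hL ZcT n (perField n (per L P') Ac))) *ᵥ ψ) ∧
    ψ ⬝ᵥ ((B4GaussRep36.deltaK (covLap (torWt n (per L P') (fineDom n (fineDom L ZcT)))
            (fieldLink F (e / n) fun u v : ↥(fineDom n (fineDom L ZcT)) => torBond n (per L P') Ac u.1 v.1)
            + m2 • (1 : Matrix _ _ ℝ)) a (QkR F e hn (fineDom L ZcT) (perField n (per L P') Ac))
          + (a' * ((L : ℝ) ^ 2)⁻¹) • pOp (((L ^ (d + 1) : ℕ) : ℝ))
              (nextAvg F (e / n) hL ZcT n (perField n (per L P') Ac))) *ᵥ ψ)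
      ≤ (a + a' * ((L : ℝ) ^ 2)⁻¹) * (ψ ⬝ᵥ ψ) :=
  fun ψ => ⟨form115_lower_torus F hn hL ZcT hZ h3 hℓ hLip he ha ha' hm hmm hc h17T hsmall hsmallU hX ψ,
    form115_upper_torus F hn hL ZcT hZ h3 ha ha'.le hm Ac ψ⟩

end Lower

end Form115

/-- `γ₀″ > 0` and `γ₁ > 0` (for the `∃ γ₀ γ₁ > 0` of the typed Proposition). [cite: Balaban1983RegularityDecay, (1.15) p.574] -/
theorem form115_torus_constants_pos {L : ℕ} (hL : 1 ≤ L) {a : ℝ} (ha : 0 < a) {a' : ℝ} (ha' : 0 < a')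
    (m2max : ℝ) : 0 < gamLow d L a a' m2max ∧ 0 < a + a' * ((L : ℝ) ^ 2)⁻¹ :=
  ⟨gamLow_pos d hL a ha' m2max, by positivity⟩

end

end Literature.MathematicalPhysics.QuantumFieldTheory.Balaban1983to89.B4Ineq115TorusRegular
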